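import Summits.ABC.ABC.Theses.RibetTakahashiSplit
import Summits.ABC.ABC.Theorems.RibetTakahashiSplitFewPrimeValuationProductSwitchingGlue
import Summits.ABC.ABC.Theorems.RibetTakahashiSplitFewPrimeValuationProductStubTwoPrimePackage
import Summits.ABC.ABC.Theorems.RibetTakahashiSplitFewPrimeValuationProductStubDepthSemistable
import Summits.ABC.ABC.Theorems.RibetTakahashiSplitFewPrimeValuationProductStubDepthFrey

/-!
# Line `switching-triangle` for crux `FewPrimeValuationProduct` (stmt-ABC-1563): position of the line

Helpers (`--supports stmt-ABC-1563`, lead c2) recording, as kernel-checked theorems over the route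
vocabulary only, WHERE the line `switching-triangle`
(`Cruxes/FewPrimeValuationProduct/Lines/switching_triangle.lean`, registered skeleton: stubs
`stub_twoPrimePackage`, `stub_twoPrimeMeanSquareLowerBound`, `stub_depthSemistable`, `stub_depthFrey`,
`stub_depthResidual`) stands after its landable pieces were landed (p99190, p100716, p142570, p142354,
p143114). Notation: `N = W.conductorNorm ℤ`, `Mult(W) = {p ∣ N prime : p² ∤ N}`,
`c_p = (W.minimalDiscriminantNorm ℤ).factorization p`, `T(W) = ∏_{p ∈ Mult} c_p`, `G(W) = gcd_{p ∈ Mult} c_p`.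

* `pairwiseGcdBound_hcard_of_fewPrimeValuationProduct` — the PAIR HALF is crux-necessary: the crux
  gives `c_p c_q ≤ C N^ε · gcd(c_p,c_q)²` for every pair of distinct multiplicative primes of a curve of
  the class (`≤ 3` odd multiplicative primes), because `c_p c_q ≤ T(W)` (all `c_r ≥ 1`) and `gcd ≥ 1`.
  This is the arithmetic shadow `PairwiseGcdBound` of package + lever (`pairwiseGcdBound_of_parts`)
  restricted to the crux's own class — the only place the composition uses it.
* `depthResidual_of_fewPrimeValuationProduct` — the DEPTH-RESIDUAL stub is crux-necessary, verbatim: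
  `G(W) ≤ c_r ≤ T(W) ≤ C N^ε` for any multiplicative `r`.
* `fewPrimeValuationProduct_of_namedFacts_of_lever_of_depthResidual` — the line's exact REACH: the crux
  follows from (i) the ten named facts of the two-prime Ribet–Takahashi–Pasten package
  (`stub_twoPrimePackage_of_facts`, p99190), (ii) Mestre–Oesterlé Thm 1 (`stub_depthSemistable_of_mestreOesterle`,
  p100716), (iii) FLT + Ribet 1997 + Darmon–Merel 1997 + Darmon–Granville Thm 2
  (`stub_depthFrey_of_namedFacts`, p142570), and the two OPEN statements: the lever
  `stub_twoPrimeMeanSquareLowerBound` ("Jacquet–Langlands preserves the size of integral newforms" at the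
  two-prime levels `(pq, N/pq)`, Pasten Conj. 1.14 strength) and `stub_depthResidual` (itself reduced to
  the hasse-pinning depth half by `stub_depthResidual_of_hasse`, p142354).

So, modulo cited theorems, the line's open content is `LEVER ∧ DEPTH-RESIDUAL`, and both conjuncts'
arithmetic content is implied by the crux (the first via its shadow). No definitions; theorems only.
-/

-- `Summit.<Summit>.<Problem>` is the mandated summit-side namespace (CONVENTIONS §2); for the
-- single-conjunct summit `ABC` the two coincide, so the duplicate `ABC.ABC` is deliberate.
set_option linter.dupNamespace false

noncomputable section

open MeasureTheory

namespace Summit.ABC.ABC.Theorems.FewPrimeValuationProduct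

open Summit.ABC.ABC.Theses.RibetTakahashiSplit (FewPrimeValuationProduct)

/-- Two distinct factors of a product of naturals `≥ 1` multiply to at most the product. [folklore] -/
theorem position_mul_le_prod {S : Finset ℕ} {f : ℕ → ℕ} (hf : ∀ r ∈ S, 1 ≤ f r) {p q : ℕ}
    (hp : p ∈ S) (hq : q ∈ S) (hpq : p ≠ q) : f p * f q ≤ ∏ r ∈ S, f r := by
  classical
  rw [← Finset.mul_prod_erase S f hp]
  refine Nat.mul_le_mul_left _ ?_
  have hq' : q ∈ S.erase p := Finset.mem_erase.mpr ⟨hpq.symm, hq⟩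
  exact Finset.single_le_prod' (fun r hr => hf r (Finset.mem_of_mem_erase hr)) hq'

/-- **The pair half is crux-necessary.** `FewPrimeValuationProduct` implies the pairwise gcd bound
`c_p c_q ≤ C N^ε gcd(c_p,c_q)²` for every two distinct multiplicative primes of every elliptic curve
semistable away from `2` with at most three odd multiplicative primes: `c_p c_q ≤ T(W) ≤ C N^ε` and
`gcd(c_p,c_q) ≥ 1`. [folklore] -/
theorem pairwiseGcdBound_hcard_of_fewPrimeValuationProduct : Summit.ABC.ABC.Theses.RibetTakahashiSplit.FewPrimeValuationProduct → ∀ ε : ℝ, 0 < ε → ∃ C : ℝ, ∀ (W : WeierstrassCurve ℚ) [W.IsElliptic], (∀ p : ℕ, p.Prime → p ≠ 2 → ¬ p ^ 2 ∣ W.conductorNorm ℤ) → ((W.conductorNorm ℤ).primeFactors.filter (fun p => p ≠ 2 ∧ ¬ p ^ 2 ∣ W.conductorNorm ℤ)).card ≤ 3 → ∀ p ∈ (W.conductorNorm ℤ).primeFactors.filter (fun p => ¬ p ^ 2 ∣ W.conductorNorm ℤ), ∀ q ∈ (W.conductorNorm ℤ).primeFactors.filter (fun p => ¬ p ^ 2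 ∣ W.conductorNorm ℤ), p ≠ q → (((W.minimalDiscriminantNorm ℤ).factorization p * (W.minimalDiscriminantNorm ℤ).factorization q : ℕ) : ℝ) ≤ C * (W.conductorNorm ℤ : ℝ) ^ ε * ((Nat.gcd ((W.minimalDiscriminantNorm ℤ).factorization p) ((W.minimalDiscriminantNorm ℤ).factorization q) ^ 2 : ℕ) : ℝ) := by
  intro hcrux ε hε
  obtain ⟨C, hC⟩ := hcrux ε hε
  refine ⟨max C 0, fun W _ hss hcard p hp q hq hpq => ?_⟩
  set S := (W.conductorNorm ℤ).primeFactors.filter (fun p => ¬ p ^ 2 ∣ W.conductorNorm ℤ) with hS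
  set c : ℕ → ℕ := fun r => (W.minimalDiscriminantNorm ℤ).factorization r with hc
  have hT := hC W hss hcard
  have hN0 : (0 : ℝ) ≤ (W.conductorNorm ℤ : ℝ) := Nat.cast_nonneg _
  have hNε : 0 ≤ (W.conductorNorm ℤ : ℝ) ^ ε := Real.rpow_nonneg hN0 ε
  have hone : ∀ r ∈ S, 1 ≤ c r := fun r hr => ManyPrimeValuationProduct.one_le_factorization_of_mem_filter W hr
  have hmul : c p * c q ≤ ∏ r ∈ S, c r := position_mul_le_prod hone hp hq hpq
  have hmulR : ((c p * c q : ℕ) : ℝ) ≤ ((∏ r ∈ S, c r : ℕ) : ℝ) := by exact_mod_cast hmul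
  have hg1 : 1 ≤ Nat.gcd (c p) (c q) := Nat.gcd_pos_of_pos_left _ (hone p hp)
  have hg1R : (1 : ℝ) ≤ ((Nat.gcd (c p) (c q) ^ 2 : ℕ) : ℝ) := by
    exact_mod_cast Nat.one_le_pow _ _ hg1
  have hmax : C * (W.conductorNorm ℤ : ℝ) ^ ε ≤ max C 0 * (W.conductorNorm ℤ : ℝ) ^ ε :=
    mul_le_mul_of_nonneg_right (le_max_left _ _) hNε
  have hK0 : 0 ≤ max C 0 * (W.conductorNorm ℤ : ℝ) ^ ε := mul_nonneg (le_max_right _ _) hNε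
  calc ((c p * c q : ℕ) : ℝ) ≤ ((∏ r ∈ S, c r : ℕ) : ℝ) := hmulR
    _ ≤ C * (W.conductorNorm ℤ : ℝ) ^ ε := hT
    _ ≤ max C 0 * (W.conductorNorm ℤ : ℝ) ^ ε := hmax
    _ = max C 0 * (W.conductorNorm ℤ : ℝ) ^ ε * 1 := (mul_one _).symm
    _ ≤ max C 0 * (W.conductorNorm ℤ : ℝ) ^ ε * ((Nat.gcd (c p) (c q) ^ 2 : ℕ) : ℝ) :=
        mul_le_mul_of_nonneg_left hg1R hK0

/-- **The depth-residual stub is crux-necessary (verbatim).** `FewPrimeValuationProduct` implies the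
statement of `stub_depthResidual`: for a multiplicative prime `r`, `G(W) ∣ c_r`, `c_r ≥ 1`, so
`G(W) ≤ c_r ≤ T(W) ≤ C N^ε`. (The additivity-at-`2` and non-Frey hypotheses are not needed.) [folklore] -/
theorem depthResidual_of_fewPrimeValuationProduct : Summit.ABC.ABC.Theses.RibetTakahashiSplit.FewPrimeValuationProduct → ∀ ε : ℝ, 0 < ε → ∃ C : ℝ, ∀ (W : WeierstrassCurve ℚ) [W.IsElliptic], (∀ p : ℕ, p.Prime → p ≠ 2 → ¬ p ^ 2 ∣ W.conductorNorm ℤ) → ((W.conductorNorm ℤ).primeFactors.filter (fun p => p ≠ 2 ∧ ¬ p ^ 2 ∣ W.conductorNorm ℤ)).card ≤ 3 → ¬ Squarefree (W.conductorNorm ℤ) → (¬ ∃ (a b d : ℤ) (C : WeierstrassCurve.VariableChange ℚ), IsCoprime a b ∧ a * b * (a + b) ≠ 0 ∧ d ∣ 2 ∧ C • W = Literature.NumberTheory.EllipticCurves.freyCurve (d * a) (d * b)) → ((W.conductorNorm ℤ).primeFactors.filter (fun p => ¬ p ^ 2 ∣ W.conductorNorm ℤ)).Nonempty → ((((W.conductorNorm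 ℤ).primeFactors.filter (fun p => ¬ p ^ 2 ∣ W.conductorNorm ℤ)).gcd (fun p => (W.minimalDiscriminantNorm ℤ).factorization p) : ℕ) : ℝ) ≤ C * (W.conductorNorm ℤ : ℝ) ^ ε := by
  intro hcrux ε hε
  obtain ⟨C, hC⟩ := hcrux ε hε
  refine ⟨max C 0, fun W _ hss hcard _ _ hne => ?_⟩
  set S := (W.conductorNorm ℤ).primeFactors.filter (fun p => ¬ p ^ 2 ∣ W.conductorNorm ℤ) with hS
  set c : ℕ → ℕ := fun r => (W.minimalDiscriminantNorm ℤ).factorization r with hc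
  have hT := hC W hss hcard
  have hN0 : (0 : ℝ) ≤ (W.conductorNorm ℤ : ℝ) := Nat.cast_nonneg _
  have hNε : 0 ≤ (W.conductorNorm ℤ : ℝ) ^ ε := Real.rpow_nonneg hN0 ε
  have hone : ∀ r ∈ S, 1 ≤ c r := fun r hr => ManyPrimeValuationProduct.one_le_factorization_of_mem_filter W hr
  obtain ⟨r, hr⟩ := hne
  have hGr : S.gcd c ≤ c r := Nat.le_of_dvd (hone r hr) (Finset.gcd_dvd hr)
  have hrT : c r ≤ ∏ s ∈ S, c s := Finset.single_le_prod' hone hr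
  have hle : ((S.gcd c : ℕ) : ℝ) ≤ ((∏ s ∈ S, c s : ℕ) : ℝ) := by exact_mod_cast hGr.trans hrT
  have hmax : C * (W.conductorNorm ℤ : ℝ) ^ ε ≤ max C 0 * (W.conductorNorm ℤ : ℝ) ^ ε :=
    mul_le_mul_of_nonneg_right (le_max_left _ _) hNε
  exact hle.trans (hT.trans hmax)

/-- **Reach of the line `switching-triangle` (closed modulo cited theorems and its two open stubs).**
The crux `FewPrimeValuationProduct` follows from: the ten named facts feeding the two-prime
Ribet–Takahashi–Pasten package (`stub_twoPrimePackage_of_facts`), Mestre–Oesterlé's Théorème 1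
(`stub_depthSemistable_of_mestreOesterle`), Fermat's Last Theorem, Ribet 1997, Darmon–Merel 1997 and
Darmon–Granville 1995 Thm 2 (`stub_depthFrey_of_namedFacts`), the OPEN two-prime mean-square lower bound
(lever, registered `stub_twoPrimeMeanSquareLowerBound`) and the OPEN residual depth bound (registered
`stub_depthResidual`, reduced to the hasse-pinning depth half by `stub_depthResidual_of_hasse`), via
`pairwiseGcdBound_of_parts` and `fewPrimeValuationProduct_of_pairwise_depth`. [folklore] -/
theorem fewPrimeValuationProduct_of_namedFacts_of_lever_of_depthResidual : Literature.NumberTheory.Automorphic.nonempty_shimuraCurveData → Literature.NumberTheory.Automorphic.ShimuraCurveData.volume_fd_eq → Literature.NumberTheory.Automorphic.nonempty_shimuraParametrizationData → Literature.NumberTheory.Automorphic.ShimuraParametrizationData.normSq_form_eq_deg_mul_covolume → Literature.NumberTheory.Automorphic.ShimuraParametrizationData.minimalDegree_le_163_mul → Literature.NumberTheory.Automorphic.PastenShimura2024_pairwise_denominator → Literature.NumberTheory.Automorphic.exists_optimal_modularParametrizationData → Literature.NumberTheory.Automorphic.PastenShimura2024_cor_10_2 → Literature.NumberTheory.Automorphic.murty_petersson_newform_upper_bound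 → Literature.NumberTheory.EllipticCurves.ModularForms.abs_neronLatticeHeight_sub_le_of_isIsogenous → Literature.NumberTheory.EllipticCurves.mestreOesterle1989_thm_1 → FermatLastTheorem → Literature.NumberTheory.DiophantineGeometry.ribet1997_twoPowerFermat → Literature.NumberTheory.DiophantineGeometry.darmonMerel1997_denesEquation → Literature.NumberTheory.DiophantineGeometry.darmonGranville1995_thm_2 → (∀ ε : ℝ, 0 < ε → ∃ C : ℝ, ∀ (W : WeierstrassCurve ℚ) [W.IsElliptic], (∀ p : ℕ, p.Prime → p ≠ 2 → ¬ p ^ 2 ∣ W.conductorNorm ℤ) → ∀ p ∈ (W.conductorNorm ℤ).primeFactors.filter (fun p => ¬ p ^ 2 ∣ W.conductorNorm ℤ), ∀ q ∈ (W.conductorNorm ℤ).primeFactors.filter (fun p => ¬ p ^ 2 ∣ W.conductorNorm ℤ), p ≠ q → ∀ (L : PeriodPair), (∃ C' : WeierstrassCurve.VariableChange ℚ, (C' • W).IsGloballyMinimal ∧ Literature.NumberTheory.EllipticCurves.ModularForms.IsNeronLatticeOf ((C' • W).baseChange ℂ) L) → ∀ (X : Literature.NumberTheory.Automorphic.ShimuraCurveData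 (p * q) (W.conductorNorm ℤ / (p * q))) (F : Set UpperHalfPlane), Literature.NumberTheory.Automorphic.IsHypFundamentalDomain X.Gamma F → MeasureTheory.volume F ≠ 0 → MeasureTheory.volume F ≠ ⊤ → ∀ (s : CuspForm X.Gamma 2), s ≠ 0 → Literature.NumberTheory.Automorphic.HasPeriodsIn X.Gamma s (L.lattice : Set ℂ) → MeasureTheory.IntegrableOn (fun z => ‖s z‖ ^ 2 * z.im ^ 2) F → (0 < ∫ z in F, ‖s z‖ ^ 2 * z.im ^ 2) → -(ε * Real.log (W.conductorNorm ℤ) + C) ≤ Real.log ((MeasureTheory.volume F).toReal⁻¹ * ∫ z in F, ‖s z‖ ^ 2 * z.im ^ 2)) → (∀ ε : ℝ, 0 < ε → ∃ C : ℝ, ∀ (W : WeierstrassCurve ℚ) [W.IsElliptic], (∀ p : ℕ, p.Prime → p ≠ 2 → ¬ p ^ 2 ∣ W.conductorNorm ℤ) → ((W.conductorNorm ℤ).primeFactors.filter (fun p => p ≠ 2 ∧ ¬ p ^ 2 ∣ W.conductorNorm ℤ)).card ≤ 3 → ¬ Squarefree (W.conductorNorm ℤ) → (¬ ∃ (a b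 d : ℤ) (C : WeierstrassCurve.VariableChange ℚ), IsCoprime a b ∧ a * b * (a + b) ≠ 0 ∧ d ∣ 2 ∧ C • W = Literature.NumberTheory.EllipticCurves.freyCurve (d * a) (d * b)) → ((W.conductorNorm ℤ).primeFactors.filter (fun p => ¬ p ^ 2 ∣ W.conductorNorm ℤ)).Nonempty → ((((W.conductorNorm ℤ).primeFactors.filter (fun p => ¬ p ^ 2 ∣ W.conductorNorm ℤ)).gcd (fun p => (W.minimalDiscriminantNorm ℤ).factorization p) : ℕ) : ℝ) ≤ C * (W.conductorNorm ℤ : ℝ) ^ ε) → Summit.ABC.ABC.Theses.RibetTakahashiSplit.FewPrimeValuationProduct :=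
  fun h₁ h₂ h₃ h₄ h₅ h₆ h₇ h₈ h₉ h₁₀ hMO hFLT hR hDM hDG hL hD =>
    fewPrimeValuationProduct_of_pairwise_depth
      (pairwiseGcdBound_of_parts (stub_twoPrimePackage_of_facts h₁ h₂ h₃ h₄ h₅ h₆ h₇ h₈ h₉ h₁₀) hL)
      (stub_depthSemistable_of_mestreOesterle hMO) (stub_depthFrey_of_namedFacts hFLT hR hDM hDG) hD

end Summit.ABC.ABC.Theorems.FewPrimeValuationProduct

end
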